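import Literature.IUT.LogThetaLattice.GlobalFrobenioidModelsTransport
import Literature.IUT.LogThetaLattice.GlobalKummerNonInterferenceCompatibleFamilies
import Literature.IUT.LogThetaLattice.LocalLogShells
import HarnessLib

/-!
# [IUTchIII] Remark 3.10.1 (i)/(ii) AT THE MODEL: the `MOD`/`𝔪𝔬𝔡` CONTRAST of the log-Kummer correspondence
# (proof-only companion; the pin of the Cor. 3.12 proof-step index at Steps (ix)/(x))

S. Mochizuki, *Inter-universal Teichmüller theory III*, kurims manuscript (May 2020) [claim: Mochizuki2012,
status: disputed — D-0012; nothing of the series is asserted here]. Remark 3.10.1 (i), pp. 149–150: the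
Kummer isomorphisms give log-link-compatible isomorphisms of Frobenioids for `𝓕⊛_MOD` "precisely because
the construction of '`(†𝓕⊛_MOD)_α`' only involves the group '`(†𝕄⊛_MOD)_α`' …"; "By contrast, the
construction of '`(†𝓕⊛_𝔪𝔬𝔡)_α`' also involves the local monoids … subject to … 'upper semi-compatibility',
i.e., in a word, one-sided inclusions, as opposed to precise equalities … In particular, one cannot
construct log-link-compatible isomorphisms of Frobenioids for '`(†𝓕⊛_𝔪𝔬𝔡)_α`' as in the first display of
Proposition 3.10, (iii)." Remark 3.10.1 (ii), p. 150: "This is precisely the reason why we wish to work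
with the LGP-, as opposed to the lgp-, Gaussian log-theta lattice". The proof of Cor. 3.12 PINS this
contrast at Step (ix) (p. 180 l. 21: "the precise compatibility of the ingredients for '`𝓕⊛_MOD`' with the
log-Kummer correspondence renders '`𝓕⊛_MOD`' better suited to describing the relation to the
`Θ^{×μ}_{LGP}`-link [cf. Remark 3.10.1, (ii)]. On the other hand, the local portion of '`𝓕⊛_𝔪𝔬𝔡`' — i.e.,
which is subject to 'upper semi-compatibility' [cf. (Ind3)], hence only 'approximately compatible' with
the log-Kummer correspondence — renders it better suited to explicit estimates") and Step (x) (p. 180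
l. 43) (plan/L6/COR312-PINS.md rows 15–16).

THE TYPED CONTRAST. abc-iut-L6-t4's statement file (`GlobalKummerNonInterference.lean`, v4 p407875) types
the contentful reading `Remark3101ii_contrast CMOD Cfrak FMOD Ffrak lgMOD lgfrak` = (a log-link-compatible
Kummer family EXISTS on the `MOD` side) ∧ (`Remark3101i_noCompatibleIso` on the `𝔪𝔬𝔡` side), and
abc-iut-L6-d3's companion (`…CompatibleFamilies.lean`, p408636) proves its exact abstract content
(`Remark3101ii_contrast_iff`: all `MOD`-side log-link maps bijective + a coric identification, versus
SOME `𝔪𝔬𝔡`-side log-link map NOT a bijection — or the junk escape `Ffrak 0 ≃ Cfrak` empty, to be excluded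
by instantiating `Cfrak` genuinely). FACT-LIST row F-2094 (`Remark3101ii_contrast`, R11 «prove or GAP»)
stood at «conditional (`Remark3101ii_contrast_of`)».

THIS FILE (abc-iut-w4-d002 gen 2; proof-only, no `def`, no new `Prop`) PROVES THE CONTRAST AT THE MODEL:

* `MOD` side = this seat's Kummer column at the number-field model (`GlobalFrobenioidModels.prop310iii_model`,
  p413222): `FMOD m` = the Ex. 3.6 (ii) objects of the model global Frobenioid of `K_m`, the log-link-induced
  maps = transports `frakTransport (κ_{m+1}⁻¹ ∘ κ_m)` along the log-Kummer field identifications — BIJECTIONS —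
  and the coric object `𝓕⊛(K_∘)` identified with the copy at `m = 0` by `frakTransport κ₀`.
* `𝔪𝔬𝔡` side = the LOCAL PORTION at a nonarchimedean place (Rmk. 3.10.1 (i): "also involves the local
  monoids"; Ex. 3.6 (ii): "'fractional ideals' `𝔍_v ⊆ K_v`"): a Frobenius-like local datum is a REGION
  `E ⊆ K_v` of the mono-analytic container, in abc-iut-L6-t3's concrete vocabulary (`LocalLogShells.lean`:
  a valuation subring `O = 𝒪_{K_v} ⊆ K_v`, the logarithm on units as an abstract homomorphism
  `logk : 𝒪^× → (K_v, +)`, `logUnits O logk = log(𝒪^×)`). The log-link `(n,m) → (n,m+1)` acts on local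
  Frobenius-like data ONLY through `log : 𝒪^× → K_v` ([IUTchIII] Def. 1.1 (i)); hence the ONLY map it
  induces on such regions has the shape `E ↦ Φ (log (E ∩ 𝒪^×))` for some post-processing `Φ` of the
  log-image (rescaling by `(p_v^*)⁻¹`, `𝒪`-span, closure, … — `Φ` is ARBITRARY below, so every such variant
  is covered). THE ONE MODELLING STEP of this file is this shape; it is stated, not hidden.
* `logImage_coe_eq_logImage_univ`: the regions `𝒪_{K_v}` and `K_v` (distinct fractional "ideals" as soon as
  the valuation is nontrivial; they differ in valuative size, i.e. in arithmetic degree) contain the same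
  units, hence have THE SAME log-image `log(𝒪^×)` — "one-sided inclusions, as opposed to precise
  equalities": the log-link sees the unit group only and forgets the module — so `E ↦ Φ (log (E ∩ 𝒪^×))` is
  NOT INJECTIVE (`logImage_comp_not_injective`), for every `Φ`; a second, characteristic-zero witness
  independent of nontriviality is Rmk. 1.2.3 (i) (`log_eq_zero_of_pow_eq_one`, L6-t3, BY NAME): the
  regions `{1}` and `{−1}` both have log-image `{0}` (`logImage_singleton_one`, `logImage_singleton_neg_one`).
* Hence `Remark3101i_noCompatibleIso` for the `𝔪𝔬𝔡`-side local column and EVERY coric object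
  (`remark3101i_noCompatibleIso_frakLocal`, by L6-d3's `Remark3101i_noCompatibleIso_of_not_bijective`), the
  junk escape being excluded (`Ffrak 0 = Set K_v ≃ Cfrak := Set K_v`, the coric container's regions —
  vertically coric by [IUTchIII] Thm. 1.5 (i)); and **`remark3101ii_contrast_model`**: the typed contrast
  HOLDS at (number-field Kummer column, local portion at `v`), by L6-d3's `Remark3101ii_contrast_of`;
  `remark3101ii_contrast_model_frak_witness` re-extracts the non-bijective `𝔪𝔬𝔡`-side map from it through
  the GENUINE coric identification (`Remark3101ii_contrast.exists_not_bijective_frak`), certifying that the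
  second conjunct holds for the printed reason and not for the junk one.

HONEST SCOPE. Model level: the `MOD` column is the tree's model global Frobenioid of a number field (all
places, `Γ_v = ℝ`); the `𝔪𝔬𝔡` datum is ONE nonarchimedean local portion with an ABSTRACT logarithm on units
(the `p_v`-adic logarithm is the intended instance; only `log(ζ) = 0` for torsion `ζ`, resp. nothing at all,
is used). What is NOT done: the ind-topological/Galois-equivariant packaging of Def. 1.1, the Frobenioid
structure of [FrdI] Def. 1.3 on `𝓕⊛_𝔪𝔬𝔡`, the realified/global assembly over all `v`. Nothing here takes a
side on [IUTchIII] Cor. 3.12 or asserts that abc is proved or refuted; typed ≠ proved elsewhere; every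
quoted sentence is [claim: Mochizuki2012, status: disputed], the mathematics being elementary (images of
sets under a homomorphism, transport of bijections).
-/

noncomputable section

namespace Literature.IUT.LogThetaLattice

universe u u'

/-! ### §1 The `𝔪𝔬𝔡`-side local portion: the log-link sees only the units -/

section FrakLocal

variable {k : Type u} [Field k] (O : ValuationSubring k) (logk : Additive (↥O)ˣ →+ k)

/-- The unit part of the region `𝒪_{K_v}` is ALL of `𝒪^×`. ([IUTchIII] Rmk 1.2.2 (i) p.36: `𝒪^▷ ⊆ 𝒪`)
[claim: Mochizuki2012, status: disputed] -/
theorem unitPart_coe_valuationSubring :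
    {x : (↥O)ˣ | ((x : ↥O) : k) ∈ (O : Set k)} = Set.univ :=
  Set.eq_univ_of_forall fun x => ((x : ↥O)).2

/-- The unit part of the whole container `K_v` is all of `𝒪^×`. [claim: Mochizuki2012, status: disputed] -/
theorem unitPart_univ : {x : (↥O)ˣ | ((x : ↥O) : k) ∈ (Set.univ : Set k)} = Set.univ :=
  Set.eq_univ_of_forall fun _ => Set.mem_univ _

/-- The log-image of the region `𝒪_{K_v}` is the pre-log-shell `log(𝒪^×)` (L6-t3's `logUnits`).
([IUTchIII] Rmk 1.2.2 (i) p.36; Def 1.1 (i) p.24) [claim: Mochizuki2012, status: disputed] -/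
theorem logImage_coe_valuationSubring :
    (fun x : (↥O)ˣ => logk (Additive.ofMul x)) '' {x : (↥O)ˣ | ((x : ↥O) : k) ∈ (O : Set k)} =
      logUnits O logk := by
  rw [unitPart_coe_valuationSubring, Set.image_univ]; rfl

/-- The log-image of the whole container `K_v` is ALSO `log(𝒪^×)`: the log-link acts through the units only.
([IUTchIII] Def 1.1 (i) p.24; Rmk 3.10.1 (i) p.149) [claim: Mochizuki2012, status: disputed] -/
theorem logImage_univ :
    (fun x : (↥O)ˣ => logk (Additive.ofMul x)) '' {x : (↥O)ˣ | ((x : ↥O) : k) ∈ (Set.univ : Set k)} =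
      logUnits O logk := by
  rw [unitPart_univ, Set.image_univ]; rfl

/-- **"One-sided inclusions, as opposed to precise equalities"**: the regions `𝒪_{K_v} ⊆ K_v` have the SAME
log-image. ([IUTchIII] Rmk 3.10.1 (i) p.149–150) [claim: Mochizuki2012, status: disputed] -/
theorem logImage_coe_eq_logImage_univ :
    (fun x : (↥O)ˣ => logk (Additive.ofMul x)) '' {x : (↥O)ˣ | ((x : ↥O) : k) ∈ (O : Set k)} =
      (fun x : (↥O)ˣ => logk (Additive.ofMul x)) '' {x : (↥O)ˣ | ((x : ↥O) : k) ∈ (Set.univ : Set k)} := by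
  rw [logImage_coe_valuationSubring, logImage_univ]

/-- For a NONTRIVIAL valuation ring (`𝒪_{K_v} ≠ K_v`, i.e. a genuine nonarchimedean place) the two regions
`𝒪_{K_v}`, `K_v` are distinct. [claim: Mochizuki2012, status: disputed] -/
theorem coe_valuationSubring_ne_univ (hO : ∃ a : k, a ∉ O) : (O : Set k) ≠ Set.univ := by
  obtain ⟨a, ha⟩ := hO
  intro h
  exact ha (show a ∈ (O : Set k) from h ▸ Set.mem_univ a)

/-- **The log-link-induced map on `𝔪𝔬𝔡`-side local regions is NOT INJECTIVE** — whatever post-processing `Φ`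
of the log-image the next column applies (rescaling by `(p_v^*)⁻¹`, `𝒪`-span, …): `𝒪_{K_v}` and `K_v` are
identified. ([IUTchIII] Rmk 3.10.1 (i) p.149–150 "one cannot construct log-link-compatible isomorphisms of
Frobenioids for '`(†𝓕⊛_𝔪𝔬𝔡)_α`'") [claim: Mochizuki2012, status: disputed] -/
theorem logImage_comp_not_injective (hO : ∃ a : k, a ∉ O) {β : Type u'} (Φ : Set k → β) :
    ¬ Function.Injective (fun E : Set k =>
        Φ ((fun x : (↥O)ˣ => logk (Additive.ofMul x)) '' {x : (↥O)ˣ | ((x : ↥O) : k) ∈ E})) := by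
  intro hinj
  have h := @hinj (O : Set k) Set.univ (by
    show Φ _ = Φ _
    rw [logImage_coe_eq_logImage_univ])
  exact coe_valuationSubring_ne_univ O hO h

/-- … hence NOT A BIJECTION. ([IUTchIII] Rmk 3.10.1 (i) p.149–150) [claim: Mochizuki2012, status: disputed] -/
theorem logImage_comp_not_bijective (hO : ∃ a : k, a ∉ O) (Φ : Set k → Set k) :
    ¬ Function.Bijective (fun E : Set k =>
        Φ ((fun x : (↥O)ˣ => logk (Additive.ofMul x)) '' {x : (↥O)ˣ | ((x : ↥O) : k) ∈ E})) :=
  fun h => logImage_comp_not_injective O logk hO Φ h.1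

/-- Second witness (Rmk. 1.2.3 (i), independent of nontriviality): the region `{1}` has log-image `{0}`.
([IUTchIII] Rmk 1.2.3 (i) p.39) [claim: Mochizuki2012, status: disputed] -/
theorem logImage_singleton_one :
    (fun x : (↥O)ˣ => logk (Additive.ofMul x)) '' {x : (↥O)ˣ | ((x : ↥O) : k) ∈ ({1} : Set k)} = {0} := by
  have hset : {x : (↥O)ˣ | ((x : ↥O) : k) ∈ ({1} : Set k)} = {1} := by
    ext x
    simp only [Set.mem_setOf_eq, Set.mem_singleton_iff]
    rw [← Units.val_eq_one, ← OneMemClass.coe_eq_one]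
  rw [hset, Set.image_singleton, ofMul_one, map_zero]

/-- … and so does the region `{−1}` (`log(−1) = 0` since `(−1)² = 1`: L6-t3's `log_eq_zero_of_pow_eq_one`
BY NAME), although `{1} ≠ {−1}` in characteristic `0`. ([IUTchIII] Rmk 1.2.3 (i) p.39)
[claim: Mochizuki2012, status: disputed] -/
theorem logImage_singleton_neg_one [CharZero k] :
    (fun x : (↥O)ˣ => logk (Additive.ofMul x)) '' {x : (↥O)ˣ | ((x : ↥O) : k) ∈ ({-1} : Set k)} =
      {0} := by
  have hset : {x : (↥O)ˣ | ((x : ↥O) : k) ∈ ({-1} : Set k)} = {-1} := by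
    ext x
    simp only [Set.mem_setOf_eq, Set.mem_singleton_iff]
    constructor
    · intro h
      apply Units.ext
      apply Subtype.ext
      rw [h, Units.val_neg, Units.val_one]
      simp
    · rintro rfl
      simp
  rw [hset, Set.image_singleton, log_eq_zero_of_pow_eq_one O logk (-1) two_ne_zero (neg_one_sq)]

/-- The torsion witness: in characteristic `0`, `E ↦ Φ (log (E ∩ 𝒪^×))` identifies the distinct regions
`{1}` and `{−1}` — NOT INJECTIVE, for every `Φ` and every valuation ring (trivial or not).
([IUTchIII] Rmk 1.2.3 (i) p.39; Rmk 3.10.1 (i) p.149–150) [claim: Mochizuki2012, status: disputed] -/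
theorem logImage_comp_not_injective_of_charZero [CharZero k] {β : Type u'} (Φ : Set k → β) :
    ¬ Function.Injective (fun E : Set k =>
        Φ ((fun x : (↥O)ˣ => logk (Additive.ofMul x)) '' {x : (↥O)ˣ | ((x : ↥O) : k) ∈ E})) := by
  intro hinj
  have h := @hinj ({1} : Set k) ({-1} : Set k) (by
    show Φ _ = Φ _
    rw [logImage_singleton_one, logImage_singleton_neg_one])
  have h1 : (1 : k) ∈ ({-1} : Set k) := h ▸ Set.mem_singleton 1
  rw [Set.mem_singleton_iff] at h1
  exact one_ne_zero (by linear_combination (1 / 2 : k) * h1 : (1 : k) = 0)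

/-- **[IUTchIII] Rmk. 3.10.1 (i) AT THE LOCAL MODEL**: for the `𝔪𝔬𝔡`-side column of local regions
`E ⊆ K_v` with log-link-induced maps `E ↦ Φ (log (E ∩ 𝒪^×))` (any post-processing `Φ`, nontrivial
valuation), "one cannot construct log-link-compatible isomorphisms" with ANY coric object `C`:
`Remark3101i_noCompatibleIso` HOLDS (by abc-iut-L6-d3's `Remark3101i_noCompatibleIso_of_not_bijective`).
([IUTchIII] Rmk 3.10.1 (i) p.149–150) [claim: Mochizuki2012, status: disputed] -/
theorem remark3101i_noCompatibleIso_frakLocal (hO : ∃ a : k, a ∉ O) (Φ : Set k → Set k) (C : Type u) :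
    Remark3101i_noCompatibleIso (C := C) (fun _ : ℤ => Set k)
      (fun (_ : ℤ) (E : Set k) =>
        Φ ((fun x : (↥O)ˣ => logk (Additive.ofMul x)) '' {x : (↥O)ˣ | ((x : ↥O) : k) ∈ E})) :=
  Remark3101i_noCompatibleIso_of_not_bijective (F := fun _ : ℤ => Set k)
    (lg := fun (_ : ℤ) (E : Set k) =>
      Φ ((fun x : (↥O)ˣ => logk (Additive.ofMul x)) '' {x : (↥O)ˣ | ((x : ↥O) : k) ∈ E}))
    (m := 0) (logImage_comp_not_bijective O logk hO Φ) C

/-- The same in characteristic `0` via the torsion witness, for an arbitrary valuation ring.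
([IUTchIII] Rmk 3.10.1 (i) p.149–150; Rmk 1.2.3 (i) p.39) [claim: Mochizuki2012, status: disputed] -/
theorem remark3101i_noCompatibleIso_frakLocal_of_charZero [CharZero k] (Φ : Set k → Set k) (C : Type u) :
    Remark3101i_noCompatibleIso (C := C) (fun _ : ℤ => Set k)
      (fun (_ : ℤ) (E : Set k) =>
        Φ ((fun x : (↥O)ˣ => logk (Additive.ofMul x)) '' {x : (↥O)ˣ | ((x : ↥O) : k) ∈ E})) :=
  Remark3101i_noCompatibleIso_of_not_bijective (F := fun _ : ℤ => Set k)
    (lg := fun (_ : ℤ) (E : Set k) =>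
      Φ ((fun x : (↥O)ˣ => logk (Additive.ofMul x)) '' {x : (↥O)ˣ | ((x : ↥O) : k) ∈ E}))
    (m := 0) (fun h => logImage_comp_not_injective_of_charZero O logk Φ h.1) C

end FrakLocal

/-! ### §2 The contrast: number-field Kummer column (`MOD`) versus local portion (`𝔪𝔬𝔡`) -/

section Contrast

open GlobalFrobenioidModels

variable {Kf : ℤ → Type u} [∀ m, Field (Kf m)] {Kc : Type u} [Field Kc]
variable {k : Type u} [Field k] (O : ValuationSubring k) (logk : Additive (↥O)ˣ →+ k)

/-- **[IUTchIII] Rmk. 3.10.1 (ii) — THE `MOD`/`𝔪𝔬𝔡` CONTRAST HOLDS AT THE MODEL.** `MOD` side: for any column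
of Kummer isomorphisms of number fields `κ_m : K_m ⥲ K_∘` (Prop. 3.10 (i)), the model global Frobenioids
`𝓕⊛(K_m)` with the log-link-induced transports along `κ_{m+1}⁻¹ ∘ κ_m` admit the log-link-compatible Kummer
family `frakTransport κ_m` to the coric `𝓕⊛(K_∘)` (`prop310iii_model`, "precise log-Kummer correspondence,
rigid"). `𝔪𝔬𝔡` side: the local portion at a nonarchimedean place — regions of `K_v` under the
log-link-induced `E ↦ Φ (log (E ∩ 𝒪^×))` — admits NO log-link-compatible family of identifications with the
coric container's regions ("upper semi-compatible … subject to substantial distortion"). By abc-iut-L6-d3's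
`Remark3101ii_contrast_of`. This is the contrast pinned by the proof of Cor. 3.12 at Steps (ix)/(x)
(p. 180). ([IUTchIII] Rmk 3.10.1 (ii) p.150; Prop 3.10 (iii) p.149; Cor 3.12 proof Step (ix) p.180)
[claim: Mochizuki2012, status: disputed] -/
theorem remark3101ii_contrast_model (κ : ∀ m, Kf m ≃+* Kc) (hO : ∃ a : k, a ∉ O) (Φ : Set k → Set k) :
    Remark3101ii_contrast (FrakObj (ModelPlaces Kc) (fun _ => ℝ)) (Set k)
      (fun m => FrakObj (ModelPlaces (Kf m)) (fun _ => ℝ)) (fun _ => Set k)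
      (fun m => ⇑(frakTransport ((κ m).trans (κ (m + 1)).symm)))
      (fun (_ : ℤ) (E : Set k) =>
        Φ ((fun x : (↥O)ˣ => logk (Additive.ofMul x)) '' {x : (↥O)ˣ | ((x : ↥O) : k) ∈ E})) :=
  Remark3101ii_contrast_of (CMOD := FrakObj (ModelPlaces Kc) (fun _ => ℝ)) (Cfrak := Set k)
    (FMOD := fun m => FrakObj (ModelPlaces (Kf m)) (fun _ => ℝ)) (Ffrak := fun _ => Set k)
    (fun m => ⇑(frakTransport ((κ m).trans (κ (m + 1)).symm)))
    (fun (_ : ℤ) (E : Set k) =>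
      Φ ((fun x : (↥O)ˣ => logk (Additive.ofMul x)) '' {x : (↥O)ˣ | ((x : ↥O) : k) ∈ E}))
    (fun m => (frakTransport ((κ m).trans (κ (m + 1)).symm)).bijective) (frakTransport (κ 0))
    (m := 0) (logImage_comp_not_bijective O logk hO Φ)

/-- The characteristic-`0` (torsion-witness) form of the contrast, for an arbitrary valuation ring of the
local container. ([IUTchIII] Rmk 3.10.1 (ii) p.150; Rmk 1.2.3 (i) p.39) [claim: Mochizuki2012, status: disputed] -/
theorem remark3101ii_contrast_model_of_charZero [CharZero k] (κ : ∀ m, Kf m ≃+* Kc)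
    (Φ : Set k → Set k) :
    Remark3101ii_contrast (FrakObj (ModelPlaces Kc) (fun _ => ℝ)) (Set k)
      (fun m => FrakObj (ModelPlaces (Kf m)) (fun _ => ℝ)) (fun _ => Set k)
      (fun m => ⇑(frakTransport ((κ m).trans (κ (m + 1)).symm)))
      (fun (_ : ℤ) (E : Set k) =>
        Φ ((fun x : (↥O)ˣ => logk (Additive.ofMul x)) '' {x : (↥O)ˣ | ((x : ↥O) : k) ∈ E})) :=
  Remark3101ii_contrast_of (CMOD := FrakObj (ModelPlaces Kc) (fun _ => ℝ)) (Cfrak := Set k)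
    (FMOD := fun m => FrakObj (ModelPlaces (Kf m)) (fun _ => ℝ)) (Ffrak := fun _ => Set k)
    (fun m => ⇑(frakTransport ((κ m).trans (κ (m + 1)).symm)))
    (fun (_ : ℤ) (E : Set k) =>
      Φ ((fun x : (↥O)ˣ => logk (Additive.ofMul x)) '' {x : (↥O)ˣ | ((x : ↥O) : k) ∈ E}))
    (fun m => (frakTransport ((κ m).trans (κ (m + 1)).symm)).bijective) (frakTransport (κ 0))
    (m := 0) (fun h => logImage_comp_not_injective_of_charZero O logk Φ h.1)

/-- **Non-vacuity of the `𝔪𝔬𝔡` conjunct**: the coric object `Set K_v` IS identified with the copy at `m = 0`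
(`Equiv.refl`), so by abc-iut-L6-d3's `Remark3101ii_contrast.exists_not_bijective_frak` the contrast yields a
genuinely NON-BIJECTIVE `𝔪𝔬𝔡`-side log-link map — the second conjunct holds for the printed reason
("one-sided inclusions"), not for the junk one (empty `Ffrak 0 ≃ Cfrak`). ([IUTchIII] Rmk 3.10.1 (i)(ii) p.149–150)
[claim: Mochizuki2012, status: disputed] -/
theorem remark3101ii_contrast_model_frak_witness (κ : ∀ m, Kf m ≃+* Kc) (hO : ∃ a : k, a ∉ O)
    (Φ : Set k → Set k) :
    ∃ m : ℤ, ¬ Function.Bijective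
      ((fun (_ : ℤ) (E : Set k) =>
        Φ ((fun x : (↥O)ˣ => logk (Additive.ofMul x)) '' {x : (↥O)ˣ | ((x : ↥O) : k) ∈ E})) m) :=
  (remark3101ii_contrast_model O logk κ hO Φ).exists_not_bijective_frak (Equiv.refl (Set k))

end Contrast

end Literature.IUT.LogThetaLattice

end
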